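import Summits.QuantumFields.BalabanUV.T4Continuum.Support.NE7SpectralResolution
import HarnessLib

/-!
# NE7SpectralClusterProjections — CLUSTER PROJECTIONS OF A SELF-ADJOINT MATRIX WHOSE SPECTRUM IS LOCALISED NEAR A SEPARATED FINITE SET: orthogonal resolution, its
# calculus, unitaries and trivial words from symbols of modulus one; the polynomial localisation test; the distance to a polynomial of the matrix
# (file S3b-3a of the `k`-uniform stabiliser lifting programme: the perturbative half of (ACU))

Cell `pub-balaban`, rung (B)+1 sub-cell t4, lineage `b2b-balaban-t4-ne7b-p1` (row NE7b OWNER + CRUX PROVER; junction service for row NE7, ruling R-OWNER-149-1 (2)),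
generation 159.  Memo `t4/b2b-balaban-t4-ne7b-p1/g159/records/S3-BRIEF.md` §2 (b).
WHAT ([folklore]; 0 def, 0 sorry; complex `n × n` matrices, Mathlib's real CFC).  For a self-adjoint `K`, a finite `S ⊂ ℝ` with `2ρ₀ ≤ |k − k′|` for distinct `k, k′ ∈ S`, and
the LOCALISATION «every point of `σ(K)` is within `ρ ≤ ρ₀` of `S`», the cluster projections `R_k = cfc 𝟙_{|u−k|<ρ₀} K` (`k ∈ S`) are self-adjoint, pairwise orthogonal
idempotents summing to `1` and commuting with the commutant of `K` (§1); `(Σ α_k R_k)(Σ β_k R_k) = Σ α_kβ_k R_k`, `(Σ α_k R_k)⋆ = Σ conj α_k R_k`, so `Σ α_k R_k` is unitary when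
`|α_k| = 1` and 4-letter words multiply symbolwise (§2); the localisation holds as soon as `‖Π(K)‖ < ρ^{#S}`, `Π = ∏_{k∈S}(X − k)` (§3, spectral mapping for polynomials +
the norm bound on the spectrum); and `‖R_k − q(K)‖ ≤ sup_{σ(K)} |𝟙_{|u−k|<ρ₀} − q|` (§4).
HONEST FRAMING (page 1): elementary finite-dimensional spectral theory; nothing of Bałaban's; NOT (ACU), NOT NE7, NOT NE3; row NE7b NOT PRINTED ∕ NOT PROVED; spine 0∕9; finite
T⁴ rung (B)+1 — NOT infinite volume, NOT mass gap, NOT BetaPertH, NOT Clay.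
-/

set_option autoImplicit false

open scoped Matrix.Norms.L2Operator BigOperators ComplexConjugate
open Finset Polynomial

namespace Summit.QuantumFields.BalabanUV.T4Continuum.NE7SpectralClusterProjections

noncomputable section

variable {n : Type} [Fintype n] [DecidableEq n]

/-! ## §1 The cluster projections -/

/-- `R_k` is self-adjoint. [folklore] -/
theorem cluster_isSelfAdjoint (K : Matrix n n ℂ) (ρ₀ k : ℝ) : IsSelfAdjoint (cfc (fun u : ℝ => if |u - k| < ρ₀ then (1 : ℝ) else 0) K) :=
  cfc_predicate _ K

/-- `R_k R_{k′} = δ_{kk′} R_k` for `k, k′` in the separated set. [folklore] -/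
theorem cluster_mul_cluster (K : Matrix n n ℂ) {S : Finset ℝ} {ρ₀ : ℝ} (hsep : ∀ k ∈ S, ∀ k' ∈ S, k ≠ k' → 2 * ρ₀ ≤ |k - k'|)
    {k k' : ℝ} (hk : k ∈ S) (hk' : k' ∈ S) :
    cfc (fun u : ℝ => if |u - k| < ρ₀ then (1 : ℝ) else 0) K * cfc (fun u : ℝ => if |u - k'| < ρ₀ then (1 : ℝ) else 0) K
      = if k = k' then cfc (fun u : ℝ => if |u - k| < ρ₀ then (1 : ℝ) else 0) K else 0 := by
  rw [← cfc_mul _ _ K (Set.Finite.continuousOn (Matrix.finite_real_spectrum (A := K)) _) (Set.Finite.continuousOn (Matrix.finite_real_spectrum (A := K)) _)]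
  split_ifs with hkk
  · subst hkk; congr 1; funext u; split_ifs <;> simp
  · have hz : (fun u : ℝ => (if |u - k| < ρ₀ then (1 : ℝ) else 0) * (if |u - k'| < ρ₀ then (1 : ℝ) else 0)) = 0 := by
      funext u
      by_cases h1 : |u - k| < ρ₀
      · have h2 : ¬ |u - k'| < ρ₀ := by
          intro h2
          have h3 := hsep k hk k' hk' hkk
          have h4 : |k - k'| ≤ |u - k| + |u - k'| := by
            calc |k - k'| = |(u - k') - (u - k)| := by ring_nf
              _ ≤ |u - k'| + |u - k| := abs_sub _ _
              _ = |u - k| + |u - k'| := add_comm _ _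
          linarith
        simp [h1, h2]
      · simp [h1]
    rw [hz, cfc_zero]

/-- Under the localisation, `Σ_{k ∈ S} R_k = 1`. [folklore] -/
theorem sum_cluster (K : Matrix n n ℂ) (hK : IsSelfAdjoint K) {S : Finset ℝ} {ρ₀ ρ : ℝ} (hsep : ∀ k ∈ S, ∀ k' ∈ S, k ≠ k' → 2 * ρ₀ ≤ |k - k'|)
    (hρ : ρ ≤ ρ₀) (hloc : ∀ u ∈ spectrum ℝ K, ∃ k ∈ S, |u - k| < ρ) :
    ∑ k ∈ S, cfc (fun u : ℝ => if |u - k| < ρ₀ then (1 : ℝ) else 0) K = 1 := by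
  rw [← cfc_sum (fun k => fun u : ℝ => if |u - k| < ρ₀ then (1 : ℝ) else 0) K S (fun k _ => Set.Finite.continuousOn (Matrix.finite_real_spectrum (A := K)) _)]
  have hcongr : (spectrum ℝ K).EqOn (∑ k ∈ S, fun u : ℝ => if |u - k| < ρ₀ then (1 : ℝ) else 0) (fun _ => 1) := by
    intro u hu
    obtain ⟨k₀, hk₀, hu0⟩ := hloc u hu
    simp only [Finset.sum_apply]
    rw [Finset.sum_eq_single_of_mem k₀ hk₀]
    · simp [hu0.trans_le hρ]
    · intro k hk hkk
      have h3 := hsep k hk k₀ hk₀ hkk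
      have : ¬ |u - k| < ρ₀ := by
        intro h1
        have h4 : |k - k₀| ≤ |u - k| + |u - k₀| := by
          calc |k - k₀| = |(u - k₀) - (u - k)| := by ring_nf
            _ ≤ |u - k₀| + |u - k| := abs_sub _ _
            _ = |u - k| + |u - k₀| := add_comm _ _
        linarith
      simp [this]
  rw [cfc_congr hcongr, cfc_const_one ℝ K]

/-- `R_k` commutes with everything commuting with `K`. [folklore] -/
theorem commute_cluster {K z : Matrix n n ℂ} (hz : Commute z K) (ρ₀ k : ℝ) : Commute z (cfc (fun u : ℝ => if |u - k| < ρ₀ then (1 : ℝ) else 0) K) :=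
  (hz.symm.cfc_real _).symm

/-! ## §2 The calculus of the cluster resolution: products, adjoints, unitaries, words -/

/-- `(Σ α_k R_k)(Σ β_k R_k) = Σ α_k β_k R_k`. [folklore] -/
theorem sum_smul_cluster_mul (K : Matrix n n ℂ) {S : Finset ℝ} {ρ₀ : ℝ} (hsep : ∀ k ∈ S, ∀ k' ∈ S, k ≠ k' → 2 * ρ₀ ≤ |k - k'|) (α β : ℝ → ℂ) :
    (∑ k ∈ S, α k • cfc (fun u : ℝ => if |u - k| < ρ₀ then (1 : ℝ) else 0) K) * (∑ k ∈ S, β k • cfc (fun u : ℝ => if |u - k| < ρ₀ then (1 : ℝ) else 0) K)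
      = ∑ k ∈ S, (α k * β k) • cfc (fun u : ℝ => if |u - k| < ρ₀ then (1 : ℝ) else 0) K := by
  rw [Finset.sum_mul_sum]
  have hterm : ∀ k ∈ S, ∀ k' ∈ S, (α k • cfc (fun u : ℝ => if |u - k| < ρ₀ then (1 : ℝ) else 0) K) * (β k' • cfc (fun u : ℝ => if |u - k'| < ρ₀ then (1 : ℝ) else 0) K)
      = if k = k' then (α k * β k) • cfc (fun u : ℝ => if |u - k| < ρ₀ then (1 : ℝ) else 0) K else 0 := by
    intro k hk k' hk'
    rw [smul_mul_smul_comm, cluster_mul_cluster K hsep hk hk']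
    split_ifs with h
    · subst h; rfl
    · rw [smul_zero]
  rw [Finset.sum_congr rfl fun k hk => Finset.sum_congr rfl fun k' hk' => hterm k hk k' hk']
  refine Finset.sum_congr rfl fun k hk => ?_
  rw [Finset.sum_ite_eq, if_pos hk]

/-- `(Σ α_k R_k)⋆ = Σ conj α_k R_k`. [folklore] -/
theorem star_sum_smul_cluster (K : Matrix n n ℂ) (S : Finset ℝ) (ρ₀ : ℝ) (α : ℝ → ℂ) :
    star (∑ k ∈ S, α k • cfc (fun u : ℝ => if |u - k| < ρ₀ then (1 : ℝ) else 0) K)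
      = ∑ k ∈ S, conj (α k) • cfc (fun u : ℝ => if |u - k| < ρ₀ then (1 : ℝ) else 0) K := by
  rw [star_sum]
  refine Finset.sum_congr rfl fun k _ => ?_
  rw [star_smul, (cluster_isSelfAdjoint K ρ₀ k).star_eq]
  rfl

/-- **UNITARITY**: if `|α_k| = 1` on `S` and the cluster resolution sums to `1`, `Σ α_k R_k` is unitary. [folklore] -/
theorem sum_smul_cluster_mem_unitary (K : Matrix n n ℂ) {S : Finset ℝ} {ρ₀ : ℝ} (hsep : ∀ k ∈ S, ∀ k' ∈ S, k ≠ k' → 2 * ρ₀ ≤ |k - k'|)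
    (hsum : ∑ k ∈ S, cfc (fun u : ℝ => if |u - k| < ρ₀ then (1 : ℝ) else 0) K = 1) {α : ℝ → ℂ} (hα : ∀ k ∈ S, ‖α k‖ = 1) :
    (∑ k ∈ S, α k • cfc (fun u : ℝ => if |u - k| < ρ₀ then (1 : ℝ) else 0) K) ∈ unitary (Matrix n n ℂ) := by
  have hαα : ∀ k ∈ S, conj (α k) * α k = 1 ∧ α k * conj (α k) = 1 := by
    intro k hk
    have h1 : α k * conj (α k) = 1 := by
      rw [Complex.mul_conj, Complex.normSq_eq_norm_sq, hα k hk]; norm_num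
    exact ⟨by rw [mul_comm]; exact h1, h1⟩
  rw [Unitary.mem_iff, star_sum_smul_cluster, sum_smul_cluster_mul K hsep, sum_smul_cluster_mul K hsep]
  constructor
  · rw [← hsum]; exact Finset.sum_congr rfl fun k hk => by rw [(hαα k hk).1, one_smul]
  · rw [← hsum]; exact Finset.sum_congr rfl fun k hk => by rw [(hαα k hk).2, one_smul]

/-- **WORDS**: `(Σα R)(Σβ R)(Σγ R)⋆(Σδ R)⋆ = Σ (α β conj γ conj δ) R`; if the symbols multiply to `1` on `S` and `Σ R = 1`, the word is `1`. [folklore] -/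
theorem word_sum_smul_cluster (K : Matrix n n ℂ) {S : Finset ℝ} {ρ₀ : ℝ} (hsep : ∀ k ∈ S, ∀ k' ∈ S, k ≠ k' → 2 * ρ₀ ≤ |k - k'|)
    (hsum : ∑ k ∈ S, cfc (fun u : ℝ => if |u - k| < ρ₀ then (1 : ℝ) else 0) K = 1) (α β γ δ : ℝ → ℂ)
    (hw : ∀ k ∈ S, α k * β k * conj (γ k) * conj (δ k) = 1) :
    (∑ k ∈ S, α k • cfc (fun u : ℝ => if |u - k| < ρ₀ then (1 : ℝ) else 0) K) * (∑ k ∈ S, β k • cfc (fun u : ℝ => if |u - k| < ρ₀ then (1 : ℝ) else 0) K)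
      * star (∑ k ∈ S, γ k • cfc (fun u : ℝ => if |u - k| < ρ₀ then (1 : ℝ) else 0) K)
      * star (∑ k ∈ S, δ k • cfc (fun u : ℝ => if |u - k| < ρ₀ then (1 : ℝ) else 0) K) = 1 := by
  rw [star_sum_smul_cluster, star_sum_smul_cluster, sum_smul_cluster_mul K hsep, sum_smul_cluster_mul K hsep, sum_smul_cluster_mul K hsep, ← hsum]
  exact Finset.sum_congr rfl fun k hk => by rw [hw k hk, one_smul]

/-! ## §3 The polynomial localisation test -/

/-- **LOCALISATION OF THE SPECTRUM NEAR `S` FROM `‖Π(K)‖ < ρ^{#S}`**, `Π = ∏_{k ∈ S} (X − k)`. [folklore] -/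
theorem localisation_of_norm_aeval_lt [Nonempty n] (K : Matrix n n ℂ) (S : Finset ℝ) {ρ : ℝ} (hρ : 0 < ρ)
    (hsmall : ‖aeval K ((∏ k ∈ S, (X - C k) : ℝ[X]))‖ < ρ ^ S.card) :
    ∀ u ∈ spectrum ℝ K, ∃ k ∈ S, |u - k| < ρ := by
  intro u hu
  by_contra hfar
  push Not at hfar
  -- the value `Π(u)` lies in the spectrum of `Π(K)`, hence below its norm
  have hmem : (∏ k ∈ S, (X - C k) : ℝ[X]).eval u ∈ spectrum ℝ (aeval K ((∏ k ∈ S, (X - C k) : ℝ[X]))) :=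
    spectrum.subset_polynomial_aeval K _ ⟨u, hu, rfl⟩
  have hbound := spectrum.subset_closedBall_norm (𝕜 := ℝ) _ hmem
  rw [Metric.mem_closedBall, dist_zero_right, Real.norm_eq_abs, Polynomial.eval_prod] at hbound
  simp only [eval_sub, eval_X, eval_C] at hbound
  rw [Finset.abs_prod] at hbound
  have hge : ρ ^ S.card ≤ ∏ k ∈ S, |u - k| := by
    rw [← Finset.prod_const]
    exact Finset.prod_le_prod (fun k _ => hρ.le) fun k hk => hfar k hk
  linarith

/-! ## §4 The distance of a cluster projection to a polynomial of the matrix -/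

/-- `‖R_k − q(K)‖ ≤ c` whenever `|𝟙_{|u−k|<ρ₀}(u) − q(u)| ≤ c` on `σ(K)` (`c ≥ 0`). [folklore] -/
theorem norm_cluster_sub_aeval_le (K : Matrix n n ℂ) (hK : IsSelfAdjoint K) (ρ₀ k : ℝ) (q : ℝ[X]) {c : ℝ} (hc : 0 ≤ c)
    (h : ∀ u ∈ spectrum ℝ K, |(if |u - k| < ρ₀ then (1 : ℝ) else 0) - q.eval u| ≤ c) :
    ‖cfc (fun u : ℝ => if |u - k| < ρ₀ then (1 : ℝ) else 0) K - aeval K q‖ ≤ c := by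
  rw [← cfc_polynomial q K, ← cfc_sub _ _ K (Set.Finite.continuousOn (Matrix.finite_real_spectrum (A := K)) _) (Set.Finite.continuousOn (Matrix.finite_real_spectrum (A := K)) _)]
  refine norm_cfc_le hc fun u hu => ?_
  rw [Real.norm_eq_abs]
  exact h u hu

end

end Summit.QuantumFields.BalabanUV.T4Continuum.NE7SpectralClusterProjections
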